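import Summits.AtomisticToContinuum.HydrodynamicLimit.Theorems.OneFlightGossipEngineClampedCurrentsDockHeartDominate
import Summits.AtomisticToContinuum.HydrodynamicLimit.Theorems.OneFlightGossipEngineClampedCurrentsDockHeartChannels
import Summits.AtomisticToContinuum.HydrodynamicLimit.Theorems.OneFlightGossipEngineClampedCurrentsDockHeartGrowth
import Summits.AtomisticToContinuum.HydrodynamicLimit.Theorems.OneFlightGossipEngineClampedCurrentsDockClampedMeasurable
import Summits.AtomisticToContinuum.HydrodynamicLimit.Theorems.OneFlightGossipEngineClampedCurrentsDockThirdMoment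
import HarnessLib

/-!
# The heart of Yau's entropy ledger — the per-window estimate (crux `ClampedCurrentsDock`, stmt-14680, line `IdeatorTwoSketch`)

Helper file (`--supports stmt-AtomisticToContinuum-14680`) for the registered stub `stub_oneWindowLedger`: for ONE window `[s, s+w]`
and ONE `N`, given the instances of the two reference-law inputs (kinetic LD at the `lo` functional, the four clamped collisional rows)
under the reference `ψ_s`, of the transfer-activity tails, of the cubic channel and of the cubic tails under the true law, the entropy
production of the window is `≤ (5/β) w KL(f_s ‖ ψ_s) + w(N+1)ε′ + w(N+1)Cst(s)`: quadratic growth (HeartGrowth), measurable versions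
(MZ, landed), the entropy inequality per channel (HeartChannels), third moments (TM, landed), the domination on the good set
(HeartDominate) and the bookkeeping of the accuracies. prover-line-stmt-AtomisticToContinuum-14680-c2-0 (lead c2).
-/

noncomputable section

namespace Summit.AtomisticToContinuum.HydrodynamicLimit.Theorems.ClampedCurrentsDockHeart

open scoped BigOperators ENNReal Classical Interval
open MeasureTheory Filter Set Topology InformationTheory
open Literature.MathematicalPhysics.KineticTheory Literature.Analysis.FluidPDE Literature.Analysis.FunctionSpaces
open Summit.AtomisticToContinuum.HydrodynamicLimit.Theorems

/-- Monotonicity of the cubic tail in the level: for `M ≤ M′`, `1{M′ < ‖v‖}‖v‖³ ≤ 1{M < ‖v‖}‖v‖³`. [folklore] -/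
theorem indicator_cube_anti {M M' : ℝ} (h : M ≤ M') (v : V3) :
    Set.indicator {v : V3 | M' < ‖v‖} (fun v => ‖v‖ ^ 3) v ≤ Set.indicator {v : V3 | M < ‖v‖} (fun v => ‖v‖ ^ 3) v :=
  Set.indicator_le_indicator_of_subset (fun v (hv : M' < ‖v‖) => h.trans_lt hv) (fun v => by positivity) _

set_option maxHeartbeats 400000 in -- one declaration: six channel instantiations against explicit window functionals
/-- **THE PER-WINDOW ESTIMATE OF THE HEART** (see the file header). [cite: Yau1991, §3; KipnisLandim1999, Ch. 6] -/
theorem window_estimate {σ T η₁ τ t s w V L Cfz CG β ε' ε₁ ε₃ M₃ : ℝ} {N : ℕ}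
    (Φ : HardSphereFlow (Torus.geometry (Fin 3)) (hsDiameter σ N) (N + 1))
    {ρ θ : ℝ → T3 → ℝ} {u : ℝ → T3 → V3} {F Rf : ℝ → ℝ} {G : ℝ → T3 × ℝ → ℝ} {a₀ θ₀ : T3 → ℝ} {u₀ : T3 → V3}
    (ha₀ : Continuous a₀) (hθ₀ : Continuous θ₀) (hu₀ : Continuous u₀) (ha₀0 : ∀ x, 0 < a₀ x) (hθ₀0 : ∀ x, 0 < θ₀ x)
    (hEul : IsHardSphereEulerSolution σ T ρ u θ) (hσ : 0 < σ) (hσ2 : σ < 1 / 2) (hη₁ : 0 < η₁)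
    (hF : AnalyticOnNhd ℝ F (Ioo (-η₁) η₁)) (hZF : ∀ η ∈ Ioo 0 η₁, hsCompressibility η = 1 + η * deriv F η)
    (hRfF : ∀ η ∈ Ioo 0 η₁, 0 < Rf η ∧ DifferentiableAt ℝ (fun x => Real.log (Rf x)) η ∧
      deriv (fun x => Real.log (Rf x)) η = 2 * deriv F η + η * deriv (deriv F) η)
    (hpackF : ∀ t' ∈ Ico 0 T, ∀ x, ρ t' x * σ ^ 3 ∈ Ioo 0 η₁)
    (ha : Torus.IsSmoothSpaceTimeOn (Ico 0 T) fun t' x => ρ t' x * Rf (σ ^ 3 * ρ t' x))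
    (ha0 : ∀ t' ∈ Ico 0 T, ∀ x, 0 < ρ t' x * Rf (σ ^ 3 * ρ t' x))
    (ht : t ∈ Ioo 0 T) (hs0 : 0 ≤ s) (hw : 0 < w) (hsw : s + w ≤ t) (hτ : 0 < τ)
    (hw_def : w = τ * ((N : ℝ) + 1) ^ (-(1 / 3 : ℝ)))
    (hV0 : 0 ≤ V) (hL0 : 0 ≤ L) (hCfz0 : 0 ≤ Cfz)
    (hLipm : ∀ (k : Fin 3) (x y : T3), |u s x k / θ s x - u s y k / θ s y| ≤ L * Torus.euclidDist x y)
    (hLipe : ∀ x y : T3, |(-(θ s x)⁻¹) - (-(θ s y)⁻¹)| ≤ L * Torus.euclidDist x y)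
    (hGs : Continuous (G s)) (hCG : ∀ y : T3 × ℝ, 0 ≤ y.2 → |G s y| ≤ CG)
    (HFZ : ∀ s₁ ∈ Icc 0 t, ∀ s₂ ∈ Icc 0 t, ∀ (x : T3) (v : V3),
      (let fast := fun (s : ℝ) (y : T3 × V3) =>
         (θ s y.1)⁻¹ * ∑ j : Fin 3, ∑ k : Fin 3,
             ((y.2 - u s y.1) j * (y.2 - u s y.1) k - (if j = k then ‖y.2 - u s y.1‖ ^ 2 / 3 else 0)) *
               Torus.partialDeriv k (fun x => u s x j) y.1 +
           (‖y.2 - u s y.1‖ ^ 2 - 5 * θ s y.1) * (∑ k : Fin 3, (y.2 - u s y.1) k * Torus.partialDeriv k (θ s) y.1) /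
             (2 * (θ s y.1) ^ 2)
       let P := fun (s : ℝ) (y : T3 × V3) =>
         (∑ k : Fin 3, Torus.partialDeriv k (fun x => u s x k / θ s x) y.1) *
           (θ s y.1 * (ρ s y.1 * σ ^ 3) * deriv hsCompressibility (ρ s y.1 * σ ^ 3) +
             (1 / 3) * (hsCompressibility (ρ s y.1 * σ ^ 3) - 1) * ‖y.2 - u s y.1‖ ^ 2) +
         ((∑ k : Fin 3, u s y.1 k * Torus.partialDeriv k (θ s) y.1) / (θ s y.1) ^ 2) *
           (θ s y.1 * (ρ s y.1 * σ ^ 3) * deriv hsCompressibility (ρ s y.1 * σ ^ 3) +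
             (1 / 3) * (hsCompressibility (ρ s y.1 * σ ^ 3) - 1) * ‖y.2 - u s y.1‖ ^ 2) +
         (hsCompressibility (ρ s y.1 * σ ^ 3) - 1) *
           (∑ k : Fin 3, (y.2 - u s y.1) k * Torus.partialDeriv k (θ s) y.1) / θ s y.1
       |fast s₁ (x, v) - fast s₂ (x, v)| ≤ Cfz * |s₁ - s₂| * (1 + ‖v‖ ^ 3) ∧
       |P s₁ (x, v) - P s₂ (x, v)| ≤ Cfz * |s₁ - s₂| * (1 + ‖v‖ ^ 2) ∧
       (∀ (k : Fin 3) (x' : T3),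
          |(u s₁ x k / θ s₁ x - u s₁ x' k / θ s₁ x') - (u s₂ x k / θ s₂ x - u s₂ x' k / θ s₂ x')| ≤
            Cfz * |s₁ - s₂| * Torus.euclidDist x x') ∧
       (∀ x' : T3, |((θ s₁ x)⁻¹ - (θ s₁ x')⁻¹) - ((θ s₂ x)⁻¹ - (θ s₂ x')⁻¹)| ≤ Cfz * |s₁ - s₂| * Torus.euclidDist x x') ∧
       (∀ (k : Fin 3) (x' : T3), |u s₁ x k / θ s₁ x - u s₁ x' k / θ s₁ x'| ≤ Cfz * Torus.euclidDist x x') ∧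
       (∀ x' : T3, |(-(θ s₁ x)⁻¹) - (-(θ s₁ x')⁻¹)| ≤ Cfz * Torus.euclidDist x x')))
    (hβ : 0 < β) (hε : 0 < ε') (hε1 : ε' ≤ 1) (hε₁ : ε₁ = β * ε' / 10) (hε₃ : ε₃ = ε' / (40 * (L + 1)))
    (hsmall : Cfz * w * (40 * (2 * (max M₃ 0) ^ 3 + 6 + V)) ≤ ε')
    -- the per-window inputs
    (hKs : ∫⁻ z, ENNReal.ofReal (Real.exp ((-β) * ∑ i : Fin (N + 1), w⁻¹ * ∫ r in (0 : ℝ)..w,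
        ((θ s (Φ.flow r z i).1)⁻¹ * ∑ j : Fin 3, ∑ k : Fin 3,
            (((Φ.flow r z i).2 - u s (Φ.flow r z i).1) j * ((Φ.flow r z i).2 - u s (Φ.flow r z i).1) k - (if j = k then ‖(Φ.flow r z i).2 - u s (Φ.flow r z i).1‖ ^ 2 / 3 else 0)) *
              Torus.partialDeriv k (fun x => u s x j) (Φ.flow r z i).1 +
          (∑ k : Fin 3, Torus.partialDeriv k (θ s) (Φ.flow r z i).1 / (2 * (θ s (Φ.flow r z i).1) ^ 2) * ((Φ.flow r z i).2 - u s (Φ.flow r z i).1) k) *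
            G s ((Φ.flow r z i).1, ‖(Φ.flow r z i).2 - u s (Φ.flow r z i).1‖ ^ 2)))) ∂(localGibbsLaw σ (fun x => ρ s x * Rf (σ ^ 3 * ρ s x)) (u s) (θ s) N Φ) ≤
      ENNReal.ofReal (Real.exp (ε₁ * ((N : ℝ) + 1))))
    (hCm : ∀ k : Fin 3, ∫⁻ z, ENNReal.ofReal (Real.exp ((-β) * (w⁻¹ * (Φ.collisionSum (Ioc 0 w) (fun c =>
          (if σ / τ * Φ.collisionSum (Ioc 0 w) (fun c' => if c'.fst = c.fst then
              ‖c'.postVel.1 - c'.preVel.1‖ + |‖c'.postVel.1‖ ^ 2 - ‖c'.preVel.1‖ ^ 2| / 2 else 0) z ≤ V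
            then (1 : ℝ) else 0) *
          (if σ / τ * Φ.collisionSum (Ioc 0 w) (fun c' => if c'.fst = c.snd then
              ‖c'.postVel.1 - c'.preVel.1‖ + |‖c'.postVel.1‖ ^ 2 - ‖c'.preVel.1‖ ^ 2| / 2 else 0) z ≤ V
            then (1 : ℝ) else 0) *
          ((u s c.fstPos k / θ s c.fstPos - u s c.sndPos k / θ s c.sndPos) * (c.postVel.1 k - c.preVel.1 k)) / 2)
          z) -
        w⁻¹ * ((∫ r in (0 : ℝ)..w, ∑ i : Fin (N + 1), (Torus.partialDeriv k (fun x => u s x k / θ s x) (Φ.flow r z i).1 *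
            (θ s (Φ.flow r z i).1 * (ρ s (Φ.flow r z i).1 * σ ^ 3) * deriv hsCompressibility (ρ s (Φ.flow r z i).1 * σ ^ 3) +
              (1 / 3) * (hsCompressibility (ρ s (Φ.flow r z i).1 * σ ^ 3) - 1) * ‖(Φ.flow r z i).2 - u s (Φ.flow r z i).1‖ ^ 2))) - (w * ((N : ℝ) + 1) * ∫ x, ρ s x * Torus.partialDeriv k (fun x => u s x k / θ s x) x *
          (θ s x * (ρ s x * σ ^ 3) * deriv hsCompressibility (ρ s x * σ ^ 3))))))) ∂(localGibbsLaw σ (fun x => ρ s x * Rf (σ ^ 3 * ρ s x)) (u s) (θ s) N Φ) ≤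
      ENNReal.ofReal (Real.exp (ε₁ / 4 * ((N : ℝ) + 1))))
    (hCe : ∫⁻ z, ENNReal.ofReal (Real.exp ((-β) * (w⁻¹ * (Φ.collisionSum (Ioc 0 w) (fun c =>
          (if σ / τ * Φ.collisionSum (Ioc 0 w) (fun c' => if c'.fst = c.fst then
              ‖c'.postVel.1 - c'.preVel.1‖ + |‖c'.postVel.1‖ ^ 2 - ‖c'.preVel.1‖ ^ 2| / 2 else 0) z ≤ V
            then (1 : ℝ) else 0) *
          (if σ / τ * Φ.collisionSum (Ioc 0 w) (fun c' => if c'.fst = c.snd then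
              ‖c'.postVel.1 - c'.preVel.1‖ + |‖c'.postVel.1‖ ^ 2 - ‖c'.preVel.1‖ ^ 2| / 2 else 0) z ≤ V
            then (1 : ℝ) else 0) *
          ((-(θ s c.fstPos)⁻¹ - -(θ s c.sndPos)⁻¹) * ((‖c.postVel.1‖ ^ 2 - ‖c.preVel.1‖ ^ 2) / 2)) / 2) z) -
        w⁻¹ * ((∫ r in (0 : ℝ)..w, ∑ i : Fin (N + 1), ((∑ l : Fin 3, u s (Φ.flow r z i).1 l * Torus.partialDeriv l (fun x => -(θ s x)⁻¹) (Φ.flow r z i).1) *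
            (θ s (Φ.flow r z i).1 * (ρ s (Φ.flow r z i).1 * σ ^ 3) * deriv hsCompressibility (ρ s (Φ.flow r z i).1 * σ ^ 3) +
              (1 / 3) * (hsCompressibility (ρ s (Φ.flow r z i).1 * σ ^ 3) - 1) * ‖(Φ.flow r z i).2 - u s (Φ.flow r z i).1‖ ^ 2) +
          θ s (Φ.flow r z i).1 * (hsCompressibility (ρ s (Φ.flow r z i).1 * σ ^ 3) - 1) *
            (∑ l : Fin 3, Torus.partialDeriv l (fun x => -(θ s x)⁻¹) (Φ.flow r z i).1 * ((Φ.flow r z i).2 - u s (Φ.flow r z i).1) l))) - (w * ((N : ℝ) + 1) * ∫ x, ρ s x * (∑ l : Fin 3, u s x l * Torus.partialDeriv l (fun x => -(θ s x)⁻¹) x) *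
          (θ s x * (ρ s x * σ ^ 3) * deriv hsCompressibility (ρ s x * σ ^ 3))))))) ∂(localGibbsLaw σ (fun x => ρ s x * Rf (σ ^ 3 * ρ s x)) (u s) (θ s) N Φ) ≤
      ENNReal.ofReal (Real.exp (ε₁ / 4 * ((N : ℝ) + 1))))
    (hTs : ∫⁻ z, ENNReal.ofReal (((N : ℝ) + 1)⁻¹ * ∑ i : Fin (N + 1),
        Set.indicator {y : ℝ | V < y} (fun y => y) (σ / τ * Φ.collisionSum (Ioc s (s + w)) (fun c => if c.fst = i then
        ‖c.postVel.1 - c.preVel.1‖ + |‖c.postVel.1‖ ^ 2 - ‖c.preVel.1‖ ^ 2| / 2 else 0) z)) ∂(localGibbsLaw σ a₀ u₀ θ₀ N Φ) ≤ ENNReal.ofReal ε₃)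
    (hQs : ∫⁻ z, ENNReal.ofReal |∫ r in s..(s + w), ∑ i : Fin (N + 1), ((∑ k : Fin 3, Torus.partialDeriv k (θ s) (Φ.flow r z i).1 / (2 * (θ s (Φ.flow r z i).1) ^ 2) * ((Φ.flow r z i).2 - u s (Φ.flow r z i).1) k) *
          (‖(Φ.flow r z i).2 - u s (Φ.flow r z i).1‖ ^ 2 - 5 * θ s (Φ.flow r z i).1 - G s ((Φ.flow r z i).1, ‖(Φ.flow r z i).2 - u s (Φ.flow r z i).1‖ ^ 2)))| ∂(localGibbsLaw σ a₀ u₀ θ₀ N Φ) ≤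
      ENNReal.ofReal (w * ((N : ℝ) + 1) * (ε' / 10)))
    (HEN : ∀ r ∈ Icc s (s + w), ∫⁻ z, ENNReal.ofReal (((N : ℝ) + 1)⁻¹ * ∑ i : Fin (N + 1),
        Set.indicator {v : V3 | M₃ < ‖v‖} (fun v => ‖v‖ ^ 3) ((Φ.flow r z i).2)) ∂(localGibbsLaw σ a₀ u₀ θ₀ N Φ) ≤ ENNReal.ofReal 1)
    (hStrI : Integrable (fun z => (∫ r' in s..(s + w), ∑ i : Fin (N + 1),
        (Torus.timeDerivWithin (Ico 0 T) (fun t'' x =>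
            Real.log (ρ t'' x * Rf (σ ^ 3 * ρ t'' x)) - 3 / 2 * Real.log (2 * Real.pi * θ t'' x) -
              ‖(Φ.flow r' z i).2 - u t'' x‖ ^ 2 / (2 * θ t'' x)) r' (Φ.flow r' z i).1 +
          ∑ k : Fin 3, (Φ.flow r' z i).2 k * Torus.partialDeriv k (fun x =>
            Real.log (ρ r' x * Rf (σ ^ 3 * ρ r' x)) - 3 / 2 * Real.log (2 * Real.pi * θ r' x) -
              ‖(Φ.flow r' z i).2 - u r' x‖ ^ 2 / (2 * θ r' x)) (Φ.flow r' z i).1))) (localGibbsLaw σ a₀ u₀ θ₀ N Φ))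
    (hColI : Integrable (fun z => (Φ.collisionSum (Ioc s (s + w)) (fun c =>
        ((∑ k : Fin 3, (u c.time c.fstPos k / θ c.time c.fstPos - u c.time c.sndPos k / θ c.time c.sndPos) *
            (c.postVel.1 k - c.preVel.1 k)) -
          ((θ c.time c.fstPos)⁻¹ - (θ c.time c.sndPos)⁻¹) * ((‖c.postVel.1‖ ^ 2 - ‖c.preVel.1‖ ^ 2) / 2)) / 2) z)) (localGibbsLaw σ a₀ u₀ θ₀ N Φ)) :
    -(∫ z, ((∫ r' in s..(s + w), ∑ i : Fin (N + 1),
        (Torus.timeDerivWithin (Ico 0 T) (fun t'' x =>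
            Real.log (ρ t'' x * Rf (σ ^ 3 * ρ t'' x)) - 3 / 2 * Real.log (2 * Real.pi * θ t'' x) -
              ‖(Φ.flow r' z i).2 - u t'' x‖ ^ 2 / (2 * θ t'' x)) r' (Φ.flow r' z i).1 +
          ∑ k : Fin 3, (Φ.flow r' z i).2 k * Torus.partialDeriv k (fun x =>
            Real.log (ρ r' x * Rf (σ ^ 3 * ρ r' x)) - 3 / 2 * Real.log (2 * Real.pi * θ r' x) -
              ‖(Φ.flow r' z i).2 - u r' x‖ ^ 2 / (2 * θ r' x)) (Φ.flow r' z i).1)) +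
      (Φ.collisionSum (Ioc s (s + w)) (fun c =>
        ((∑ k : Fin 3, (u c.time c.fstPos k / θ c.time c.fstPos - u c.time c.sndPos k / θ c.time c.sndPos) *
            (c.postVel.1 k - c.preVel.1 k)) -
          ((θ c.time c.fstPos)⁻¹ - (θ c.time c.sndPos)⁻¹) * ((‖c.postVel.1‖ ^ 2 - ‖c.preVel.1‖ ^ 2) / 2)) / 2) z)) ∂(localGibbsLaw σ a₀ u₀ θ₀ N Φ)) ≤
      5 / β * w * (klDiv (Φ.lawAt (localGibbsLaw σ a₀ u₀ θ₀ N Φ) s) (localGibbsLaw σ (fun x => ρ s x * Rf (σ ^ 3 * ρ s x)) (u s) (θ s) N Φ)).toReal + w * ((N : ℝ) + 1) * ε' +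
        w * ((N : ℝ) + 1) * (∫ x, ρ s x * (ρ s x * σ ^ 3) * deriv hsCompressibility (ρ s x * σ ^ 3) * Torus.divergence (u s) x) := by
  subst hw_def
  set P := localGibbsLaw σ a₀ u₀ θ₀ N Φ with hP_def
  have hgood : ∀ᵐ z ∂P, z ∈ Φ.good := ae_mem_good_localGibbsLaw σ a₀ u₀ θ₀ N Φ
  haveI : IsProbabilityMeasure P := isProbabilityMeasure_localGibbsLaw ha₀ hθ₀ hu₀ ha₀0 hθ₀0 hσ2.le N Φ
  have hsw' : s ≤ s + (τ * ((N : ℝ) + 1) ^ (-(1 / 3 : ℝ))) := le_add_of_nonneg_right hw.le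
  have hsT : s ∈ Set.Ico 0 T := ⟨hs0, (hsw'.trans hsw).trans_lt ht.2⟩
  have hIcc_t : Set.Icc s (s + (τ * ((N : ℝ) + 1) ^ (-(1 / 3 : ℝ)))) ⊆ Set.Icc 0 t := fun r hr => ⟨hs0.trans hr.1, hr.2.trans hsw⟩
  have hM0 : 0 ≤ max M₃ 0 := le_max_right _ _
  -- slices at the window start
  have hθs : Torus.IsSmooth (θ s) := hEul.smooth_temperature.isSmooth_slice hsT
  have hus : Torus.IsSmooth (u s) := hEul.smooth_velocity.isSmooth_slice hsT
  have hρsc : Continuous (ρ s) := (hEul.smooth_density.isSmooth_slice hsT).continuous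
  have hθsc : Continuous (θ s) := hθs.continuous
  have husc : Continuous (u s) := hus.continuous
  have hθs0 : ∀ x, 0 < θ s x := hEul.temperature_pos s hsT
  have has_c : Continuous fun x => ρ s x * Rf (σ ^ 3 * ρ s x) := (ha.isSmooth_slice hsT).continuous
  have has_0 : ∀ x, 0 < ρ s x * Rf (σ ^ 3 * ρ s x) := ha0 s hsT
  obtain ⟨hZst, hZ'st⟩ := ClampedCurrentsDockFreezeToolkit.sst_hsCompressibility_comp (S := Set.Ico 0 T) hF hZF
    hEul.smooth_density hpackF
  have hZc : Continuous fun x => hsCompressibility (ρ s x * σ ^ 3) := (hZst.isSmooth_slice hsT).continuous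
  have hZ'c : Continuous fun x => deriv hsCompressibility (ρ s x * σ ^ 3) := (hZ'st.isSmooth_slice hsT).continuous
  -- quadratic growth of the frozen integrands
  obtain ⟨Clo, hloc, hloC⟩ := exists_growth_lo (Gs := G s) (CG := CG) hθs hus hθs0 hGs hCG
  choose CF hFkc hFkC using fun k : Fin 3 => exists_growth_rowk (ρ₀ := ρ s)
    (Zf := fun x => hsCompressibility (ρ s x * σ ^ 3)) (Z'f := fun x => deriv hsCompressibility (ρ s x * σ ^ 3)) σ k
    hθs hus hθs0 hρsc hZc hZ'c
  obtain ⟨CE, hFec, hFeC⟩ := exists_growth_rowe (ρ₀ := ρ s)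
    (Zf := fun x => hsCompressibility (ρ s x * σ ^ 3)) (Z'f := fun x => deriv hsCompressibility (ρ s x * σ ^ 3)) σ
    hθs hus hθs0 hρsc hZc hZ'c
  -- measurable versions and bounds of the clamped functionals (MZ, landed)
  obtain ⟨hMA, -, hMY, ⟨Ye, hYem, hYe⟩, hMbm, hMbe⟩ :=
    ClampedCurrentsDockClampedMeasurable.stub_clampedFunctionalsMeasurable σ N Φ (θ s) (u s) V τ L hσ hσ2 hτ hθsc husc
      hθs0 hL0 hLipm hLipe
  choose A hAm hA using hMA
  choose Ym hYmm hYm using hMY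
  obtain ⟨hFS, -⟩ := ClampedCurrentsDockFlowShiftFreeze.stub_flowShiftFreeze
  -- the functionals of the ledger
  set loF : T3 × V3 → ℝ := fun y =>
    (θ s y.1)⁻¹ * ∑ j : Fin 3, ∑ k : Fin 3,
        ((y.2 - u s y.1) j * (y.2 - u s y.1) k - (if j = k then ‖y.2 - u s y.1‖ ^ 2 / 3 else 0)) *
          Torus.partialDeriv k (fun x => u s x j) y.1 +
      (∑ k : Fin 3, Torus.partialDeriv k (θ s) y.1 / (2 * (θ s y.1) ^ 2) * (y.2 - u s y.1) k) *
        G s (y.1, ‖y.2 - u s y.1‖ ^ 2) with hloF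
  set hiF : T3 × V3 → ℝ := fun y =>
    (∑ k : Fin 3, Torus.partialDeriv k (θ s) y.1 / (2 * (θ s y.1) ^ 2) * (y.2 - u s y.1) k) *
      (‖y.2 - u s y.1‖ ^ 2 - 5 * θ s y.1 - G s (y.1, ‖y.2 - u s y.1‖ ^ 2)) with hhiF
  set Fk : Fin 3 → T3 × V3 → ℝ := fun k y => Torus.partialDeriv k (fun x => u s x k / θ s x) y.1 *
    (θ s y.1 * (ρ s y.1 * σ ^ 3) * deriv hsCompressibility (ρ s y.1 * σ ^ 3) +
      (1 / 3) * (hsCompressibility (ρ s y.1 * σ ^ 3) - 1) * ‖y.2 - u s y.1‖ ^ 2) with hFk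
  set ck : Fin 3 → ℝ := fun k => (τ * ((N : ℝ) + 1) ^ (-(1 / 3 : ℝ))) * ((N : ℝ) + 1) * ∫ x, ρ s x * Torus.partialDeriv k (fun x => u s x k / θ s x) x *
    (θ s x * (ρ s x * σ ^ 3) * deriv hsCompressibility (ρ s x * σ ^ 3)) with hck
  set Xk : Fin 3 → Config (N + 1) (Fin 3) T3 → ℝ := fun k z => Φ.collisionSum (Set.Ioc 0 (τ * ((N : ℝ) + 1) ^ (-(1 / 3 : ℝ))))
    (fun c => (if σ / τ * Φ.collisionSum (Set.Ioc 0 (τ * ((N : ℝ) + 1) ^ (-(1 / 3 : ℝ)))) (fun c' => if c'.fst = c.fst then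
          ‖c'.postVel.1 - c'.preVel.1‖ + |‖c'.postVel.1‖ ^ 2 - ‖c'.preVel.1‖ ^ 2| / 2 else 0) z ≤ V then (1 : ℝ) else 0) *
      (if σ / τ * Φ.collisionSum (Set.Ioc 0 (τ * ((N : ℝ) + 1) ^ (-(1 / 3 : ℝ)))) (fun c' => if c'.fst = c.snd then
          ‖c'.postVel.1 - c'.preVel.1‖ + |‖c'.postVel.1‖ ^ 2 - ‖c'.preVel.1‖ ^ 2| / 2 else 0) z ≤ V then (1 : ℝ) else 0) *
      ((u s c.fstPos k / θ s c.fstPos - u s c.sndPos k / θ s c.sndPos) * (c.postVel.1 k - c.preVel.1 k)) / 2) z with hXk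
  set Fe : T3 × V3 → ℝ := fun y =>
    (∑ l : Fin 3, u s y.1 l * Torus.partialDeriv l (fun x => -(θ s x)⁻¹) y.1) *
        (θ s y.1 * (ρ s y.1 * σ ^ 3) * deriv hsCompressibility (ρ s y.1 * σ ^ 3) +
          (1 / 3) * (hsCompressibility (ρ s y.1 * σ ^ 3) - 1) * ‖y.2 - u s y.1‖ ^ 2) +
      θ s y.1 * (hsCompressibility (ρ s y.1 * σ ^ 3) - 1) *
        (∑ l : Fin 3, Torus.partialDeriv l (fun x => -(θ s x)⁻¹) y.1 * (y.2 - u s y.1) l) with hFe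
  set ce : ℝ := (τ * ((N : ℝ) + 1) ^ (-(1 / 3 : ℝ))) * ((N : ℝ) + 1) * ∫ x, ρ s x * (∑ l : Fin 3, u s x l * Torus.partialDeriv l (fun x => -(θ s x)⁻¹) x) *
    (θ s x * (ρ s x * σ ^ 3) * deriv hsCompressibility (ρ s x * σ ^ 3)) with hce
  set Xe : Config (N + 1) (Fin 3) T3 → ℝ := fun z => Φ.collisionSum (Set.Ioc 0 (τ * ((N : ℝ) + 1) ^ (-(1 / 3 : ℝ))))
    (fun c => (if σ / τ * Φ.collisionSum (Set.Ioc 0 (τ * ((N : ℝ) + 1) ^ (-(1 / 3 : ℝ)))) (fun c' => if c'.fst = c.fst then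
          ‖c'.postVel.1 - c'.preVel.1‖ + |‖c'.postVel.1‖ ^ 2 - ‖c'.preVel.1‖ ^ 2| / 2 else 0) z ≤ V then (1 : ℝ) else 0) *
      (if σ / τ * Φ.collisionSum (Set.Ioc 0 (τ * ((N : ℝ) + 1) ^ (-(1 / 3 : ℝ)))) (fun c' => if c'.fst = c.snd then
          ‖c'.postVel.1 - c'.preVel.1‖ + |‖c'.postVel.1‖ ^ 2 - ‖c'.preVel.1‖ ^ 2| / 2 else 0) z ≤ V then (1 : ℝ) else 0) *
      ((-(θ s c.fstPos)⁻¹ - -(θ s c.sndPos)⁻¹) * ((‖c.postVel.1‖ ^ 2 - ‖c.preVel.1‖ ^ 2) / 2)) / 2) z with hXe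
  set Jk : Fin 3 → Config (N + 1) (Fin 3) T3 → ℝ := fun k z =>
    ((∫ r' in s..(s + (τ * ((N : ℝ) + 1) ^ (-(1 / 3 : ℝ)))), ∑ i, Fk k (Φ.flow r' z i)) - ck k) - Xk k (Φ.flow s z) with hJk
  set Je : Config (N + 1) (Fin 3) T3 → ℝ := fun z =>
    ((∫ r' in s..(s + (τ * ((N : ℝ) + 1) ^ (-(1 / 3 : ℝ)))), ∑ i, Fe (Φ.flow r' z i)) - ce) - Xe (Φ.flow s z) with hJe
  set actT : Fin (N + 1) → Config (N + 1) (Fin 3) T3 → ℝ := fun i z => σ / τ * Φ.collisionSum (Set.Ioc s (s + (τ * ((N : ℝ) + 1) ^ (-(1 / 3 : ℝ)))))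
    (fun c => if c.fst = i then ‖c.postVel.1 - c.preVel.1‖ + |‖c.postVel.1‖ ^ 2 - ‖c.preVel.1‖ ^ 2| / 2 else 0) z
    with hactT
  set tail : Config (N + 1) (Fin 3) T3 → ℝ := fun z => ∑ i, Set.indicator {y : ℝ | V < y} (fun y => y) (actT i z) with htail
  set cub : Config (N + 1) (Fin 3) T3 → ℝ := fun z => ∫ r' in s..(s + (τ * ((N : ℝ) + 1) ^ (-(1 / 3 : ℝ)))), ∑ i, ‖(Φ.flow r' z i).2‖ ^ 3 with hcub
  set hiT : Config (N + 1) (Fin 3) T3 → ℝ := fun z => |∫ r' in s..(s + (τ * ((N : ℝ) + 1) ^ (-(1 / 3 : ℝ)))), ∑ i, hiF (Φ.flow r' z i)| with hhiT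
  set kin : Config (N + 1) (Fin 3) T3 → ℝ := fun z => -(∫ r' in s..(s + (τ * ((N : ℝ) + 1) ^ (-(1 / 3 : ℝ)))), ∑ i, loF (Φ.flow r' z i)) with hkin
  set Hs : ℝ := (klDiv (Φ.lawAt P s) (localGibbsLaw σ (fun x => ρ s x * Rf (σ ^ 3 * ρ s x)) (u s) (θ s) N Φ)).toReal with hHs
  -- ===== the channels in expectation =====
  have hkinI : Integrable kin P ∧ ∫ z, kin z ∂P ≤ (τ * ((N : ℝ) + 1) ^ (-(1 / 3 : ℝ))) * (β⁻¹ * (Hs + ε₁ * ((N : ℝ) + 1))) :=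
    kinetic_expectation Φ (a₀ := a₀) (θ₀ := θ₀) (u₀ := u₀) (b := fun x => ρ s x * Rf (σ ^ 3 * ρ s x)) (ϑ := θ s)
      (wv := u s) (lo := loF) (C := Clo) (γ := β) (B := ε₁ * ((N : ℝ) + 1)) (s := s) (w := (τ * ((N : ℝ) + 1) ^ (-(1 / 3 : ℝ)))) hσ hσ2 ha₀ hθ₀ hu₀ ha₀0 hθ₀0
      has_c hθsc husc has_0 hθs0 hloc hloC hs0 hw hβ hKs
  have hJkI : ∀ k, Integrable (Jk k) P ∧ ∫ z, Jk k z ∂P ≤ (τ * ((N : ℝ) + 1) ^ (-(1 / 3 : ℝ))) * (β⁻¹ * (Hs + ε₁ / 4 * ((N : ℝ) + 1))) := fun k =>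
    row_expectation Φ (a₀ := a₀) (θ₀ := θ₀) (u₀ := u₀) (b := fun x => ρ s x * Rf (σ ^ 3 * ρ s x)) (ϑ := θ s) (wv := u s)
      (F := Fk k) (X := Xk k) (C := CF k) (Mx := L * (τ * ((N : ℝ) + 1) ^ (-(1 / 3 : ℝ))) * ((N : ℝ) + 1) * max V 0) (γ := β)
      (B := ε₁ / 4 * ((N : ℝ) + 1)) (s := s) (w := (τ * ((N : ℝ) + 1) ^ (-(1 / 3 : ℝ)))) (c := ck k) hσ hσ2 ha₀ hθ₀ hu₀ ha₀0 hθ₀0 has_c hθsc husc has_0 hθs0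
      (hFkc k) (hFkC k) ⟨Ym k, hYmm k, hYm k⟩ (fun z hz => hMbm z hz k) hs0 hw hβ (hCm k)
  have hJeI : Integrable Je P ∧ ∫ z, Je z ∂P ≤ (τ * ((N : ℝ) + 1) ^ (-(1 / 3 : ℝ))) * (β⁻¹ * (Hs + ε₁ / 4 * ((N : ℝ) + 1))) :=
    row_expectation Φ (a₀ := a₀) (θ₀ := θ₀) (u₀ := u₀) (b := fun x => ρ s x * Rf (σ ^ 3 * ρ s x)) (ϑ := θ s) (wv := u s)
      (F := Fe) (X := Xe) (C := CE) (Mx := L * (τ * ((N : ℝ) + 1) ^ (-(1 / 3 : ℝ))) * ((N : ℝ) + 1) * max V 0) (γ := β)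
      (B := ε₁ / 4 * ((N : ℝ) + 1)) (s := s) (w := (τ * ((N : ℝ) + 1) ^ (-(1 / 3 : ℝ)))) (c := ce) hσ hσ2 ha₀ hθ₀ hu₀ ha₀0 hθ₀0 has_c hθsc husc has_0 hθs0
      hFec hFeC ⟨Ye, hYem, hYe⟩ hMbe hs0 hw hβ hCe
  have hJsumI : Integrable (fun z => (∑ k, Jk k z) + Je z) P := (integrable_finsetSum _ fun k _ => (hJkI k).1).add hJeI.1
  have hJsum : Integrable (fun z => (∑ k, Jk k z) + Je z) P ∧
      ∫ z, ((∑ k, Jk k z) + Je z) ∂P ≤ 4 * ((τ * ((N : ℝ) + 1) ^ (-(1 / 3 : ℝ))) * (β⁻¹ * (Hs + ε₁ / 4 * ((N : ℝ) + 1)))) := by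
    refine ⟨hJsumI, ?_⟩
    rw [integral_add (integrable_finsetSum _ fun k _ => (hJkI k).1) hJeI.1, integral_finsetSum _ fun k _ => (hJkI k).1]
    have h3 : ∑ k : Fin 3, ∫ z, Jk k z ∂P ≤ ∑ _k : Fin 3, (τ * ((N : ℝ) + 1) ^ (-(1 / 3 : ℝ))) * (β⁻¹ * (Hs + ε₁ / 4 * ((N : ℝ) + 1))) :=
      Finset.sum_le_sum fun k _ => (hJkI k).2
    rw [Finset.sum_const, Finset.card_univ, Fintype.card_fin] at h3
    simp only [nsmul_eq_mul, Nat.cast_ofNat] at h3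
    linarith [hJeI.2]
  have hhic : Continuous hiF := by
    have hθne : ∀ y : T3 × V3, θ s y.1 ≠ 0 := fun y => (hθs0 _).ne'
    have hDθc : ∀ k, Continuous (Torus.partialDeriv k (θ s)) := fun k => (hθs.partialDeriv k).continuous
    simp only [hhiF]
    fun_prop (disch := (intro y; exact mul_ne_zero two_ne_zero (pow_ne_zero _ (hθne y))))
  have hhiTI : Integrable hiT P ∧ ∫ z, hiT z ∂P ≤ (τ * ((N : ℝ) + 1) ^ (-(1 / 3 : ℝ))) * ((N : ℝ) + 1) * (ε' / 10) := by
    refine integral_le_of_good_version Φ a₀ θ₀ u₀ ?_ (fun z _ => abs_nonneg _) (by positivity) hQs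
    refine exists_measurable_eqOn_good Φ ?_
    have hm := measurable_sum_windowIntegral Φ hhic s (s + (τ * ((N : ℝ) + 1) ^ (-(1 / 3 : ℝ))))
    have heq : (fun z : Φ.good => hiT z) = fun z : Φ.good =>
        |∑ i, ∫ r' in s..(s + (τ * ((N : ℝ) + 1) ^ (-(1 / 3 : ℝ)))), hiF (Φ.flow r' (z : Config (N + 1) (Fin 3) T3) i)| := by
      funext z; simp only [hhiT, integral_sum_orbit Φ z.2 hhic]
    rw [heq]
    exact continuous_abs.measurable.comp hm
  have hcubI : Integrable cub P ∧ ∫ z, cub z ∂P ≤ (τ * ((N : ℝ) + 1) ^ (-(1 / 3 : ℝ))) * ((N : ℝ) + 1) * ((max M₃ 0) ^ 3 + 1) := by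
    refine integral_le_of_good_version Φ a₀ θ₀ u₀ ?_ ?_ (by positivity) ?_
    · refine exists_measurable_eqOn_good Φ ?_
      have hm := measurable_sum_windowIntegral Φ (F := fun y : T3 × V3 => ‖y.2‖ ^ 3) (by fun_prop) s (s + (τ * ((N : ℝ) + 1) ^ (-(1 / 3 : ℝ))))
      have heq : (fun z : Φ.good => cub z) = fun z : Φ.good =>
          ∑ i, ∫ r' in s..(s + (τ * ((N : ℝ) + 1) ^ (-(1 / 3 : ℝ)))), ‖(Φ.flow r' (z : Config (N + 1) (Fin 3) T3) i).2‖ ^ 3 := by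
        funext z
        exact integral_sum_orbit Φ z.2 (F := fun y : T3 × V3 => ‖y.2‖ ^ 3) (by fun_prop) s (s + (τ * ((N : ℝ) + 1) ^ (-(1 / 3 : ℝ))))
      rw [heq]; exact hm
    · intro z _
      exact intervalIntegral.integral_nonneg hsw' fun r _ => Finset.sum_nonneg fun i _ => by positivity
    · refine ClampedCurrentsDockThirdMoment.stub_thirdMomentWindow σ N Φ a₀ θ₀ u₀ (max M₃ 0) s (τ * ((N : ℝ) + 1) ^ (-(1 / 3 : ℝ))) hσ hσ2 ha₀ hθ₀ hu₀
        ha₀0 hθ₀0 hM0 hs0 hw.le fun r hr => ?_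
      refine le_trans (lintegral_mono fun z => ENNReal.ofReal_le_ofReal ?_) (HEN r hr)
      refine mul_le_mul_of_nonneg_left (Finset.sum_le_sum fun i _ => ?_) (by positivity)
      exact indicator_cube_anti (le_max_left M₃ 0) _
  have htailI : Integrable tail P ∧ ∫ z, tail z ∂P ≤ ((N : ℝ) + 1) * ε₃ := by
    refine integral_le_of_good_version Φ a₀ θ₀ u₀ ?_ ?_ (by rw [hε₃]; positivity) (lintegral_le_of_normalised hTs)
    · refine ⟨fun z => ∑ i, Set.indicator {y : ℝ | V < y} (fun y => y) (A i (Φ.flow s z)), ?_, ?_⟩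
      · exact Finset.measurable_sum _ fun i _ =>
          (measurable_id.indicator measurableSet_Ioi).comp ((hAm i).comp (Φ.measurable_flow s))
      · intro z hz
        simp only [htail]
        refine Finset.sum_congr rfl fun i _ => ?_
        rw [hA i (Φ.mapsTo_good s hz)]
        simp only [hactT]
        rw [← (hFS σ N Φ s (τ * ((N : ℝ) + 1) ^ (-(1 / 3 : ℝ))) hs0 hw.le z hz).2]
    · intro z _
      exact Finset.sum_nonneg fun i _ => indicator_tail_nonneg hV0
  -- ===== the domination on the good set and the bookkeeping =====
  have hX := hStrI.add hColI
  have hdom : ∀ z ∈ Φ.good, -((∫ r' in s..(s + (τ * ((N : ℝ) + 1) ^ (-(1 / 3 : ℝ)))), ∑ i : Fin (N + 1),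
        (Torus.timeDerivWithin (Ico 0 T) (fun t'' x =>
            Real.log (ρ t'' x * Rf (σ ^ 3 * ρ t'' x)) - 3 / 2 * Real.log (2 * Real.pi * θ t'' x) -
              ‖(Φ.flow r' z i).2 - u t'' x‖ ^ 2 / (2 * θ t'' x)) r' (Φ.flow r' z i).1 +
          ∑ k : Fin 3, (Φ.flow r' z i).2 k * Torus.partialDeriv k (fun x =>
            Real.log (ρ r' x * Rf (σ ^ 3 * ρ r' x)) - 3 / 2 * Real.log (2 * Real.pi * θ r' x) -
              ‖(Φ.flow r' z i).2 - u r' x‖ ^ 2 / (2 * θ r' x)) (Φ.flow r' z i).1)) +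
      (Φ.collisionSum (Ioc s (s + (τ * ((N : ℝ) + 1) ^ (-(1 / 3 : ℝ))))) (fun c =>
        ((∑ k : Fin 3, (u c.time c.fstPos k / θ c.time c.fstPos - u c.time c.sndPos k / θ c.time c.sndPos) *
            (c.postVel.1 k - c.preVel.1 k)) -
          ((θ c.time c.fstPos)⁻¹ - (θ c.time c.sndPos)⁻¹) * ((‖c.postVel.1‖ ^ 2 - ‖c.preVel.1‖ ^ 2) / 2)) / 2) z)) ≤
      kin z + hiT z + (fun z => (∑ k, Jk k z) + Je z) z + (2 * L * (τ * ((N : ℝ) + 1) ^ (-(1 / 3 : ℝ))) + 2 * Cfz * (τ * ((N : ℝ) + 1) ^ (-(1 / 3 : ℝ))) ^ 2) * tail z +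
        (2 * Cfz * (τ * ((N : ℝ) + 1) ^ (-(1 / 3 : ℝ)))) * cub z + ((τ * ((N : ℝ) + 1) ^ (-(1 / 3 : ℝ))) * ((N : ℝ) + 1) * (∫ x, ρ s x * (ρ s x * σ ^ 3) * deriv hsCompressibility (ρ s x * σ ^ 3) * Torus.divergence (u s) x) + 3 * Cfz * (τ * ((N : ℝ) + 1) ^ (-(1 / 3 : ℝ))) ^ 2 * ((N : ℝ) + 1) +
          2 * Cfz * (τ * ((N : ℝ) + 1) ^ (-(1 / 3 : ℝ))) ^ 2 * (((N : ℝ) + 1) * V)) := fun z hz =>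
    window_domination Φ hEul hσ hσ2 hη₁ hF hZF hRfF hpackF ha ha0 ht hs0 hw hsw hτ rfl hV0 hL0 hCfz0 hLipm hLipe hGs HFZ hz
  exact window_bookkeeping hgood (Hs := Hs) (Nr := (N : ℝ) + 1) (M := max M₃ 0) hw hβ hε hε1 hL0 hCfz0 hM0 hV0 (by positivity)
    hε₁ hε₃ hsmall hX hdom hkinI hhiTI hJsum htailI hcubI

end Summit.AtomisticToContinuum.HydrodynamicLimit.Theorems.ClampedCurrentsDockHeart

end
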